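import Literature.MathematicalPhysics.QuantumFieldTheory.Balaban1983to89.B9Cor35GDirKnitInputsAtOne
import Literature.MathematicalPhysics.QuantumFieldTheory.Balaban1983to89.B9Cor36GCubeRightEntryAtLocCfg

/-!
# `Balaban1983to89.B9Prop26DirichletBondReadingRight` — [Balaban1984PropagatorsII] Prop. 2.6 (2.136) p. 247 FOR THE DIRICHLET BOND KERNEL OF THE CUBE
# SEQUENCE `{Ω_n(□)}` WITH ITS THIRD ENTRY `|(G∇*J)(x)| ≤ O(1)·Lʲη·e^{−δ₃d(y,y′)}|J|` READ: the right-entry edition `gFamOfKernelBR` of g33's ✓`gFamOfKernelB`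
# (which set `e 2 := 0`), the reading `Ineq2136_2140 ⇒ K·∇*_ν ≺ C·Lⁿη·e^{−δ₃d}`, the instance `GDirBFamR` of `B6.Prop26DirichletPrinted` at print's Dirichlet bond
# letter `G_□(1) = kDirC∣_B`, `h26R ⇒ h26`, and ★★★ [Balaban1985BackgroundPropagators] Theorem 3.3 (3.42)₃ at `U = 1` for the realified letter of record
# `GiK b i (TKnitCY i □ 1) B · conj b(∇*_{1,ν}) ≺ C·Lⁿη·e^{−δ₃d}` CONDITIONAL BY NAME on `h26R` — the Dirichlet twin of p33's E1 ✓`B9Thm33CubeAtOneRight.thm33_GK_cube_right`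
# (seat dag-n06-c g36, FILE R1 of «E2 BY NAME»: the right entry (3.42)₃ of the Dirichlet bond letter of record, cell GAPS G-B9-02)

statement-level skeleton of published theorems with citation tags; proofs where landed; nothing here is a claim about the Yang–Mills mass gap

CITATION HEADER (lean-in-tree rule).  [4] = B6 = T. Bałaban, *Propagators and renormalization transformations for lattice gauge theories. II*, Commun.
Math. Phys. **96** (1984) 223–250 [Balaban1984PropagatorsII] (held `paper:balaban1984-cmp96-propagators-rt-ii`; journal page = PDF page + 222): Prop. 2.6
(2.136) p. 247 «|(GJ)(x)|, |(∇GJ)(x)|, |(G∇*J)(x)|, |(ΔGJ)(x)| ≤ O(1)[(L^jη)², L^jη, L^jη, 1]e^{−δ₃d(y,y′)}|J| for x ∈ Δ(y), y ∈ Λ_j, supp J ⊂ Δ(y′)» — the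
THIRD entry is printed on the same line as the other three; p. 228 after (2.35) and p. 248 l. 4–5 («this theorem holds for the operators G(Ω) with Dirichlet
boundary conditions on Ωᶜ, Ω ⊃ Ω₁») — the tree's named printed assertion `B6.Prop26DirichletPrinted` (✓`B6Prop26DirichletPrinted`, lit-balaban typer g57);
(2.51) p. 232 (block majorants).  B9 = T. Bałaban, *Propagators for lattice gauge theories in a background field*, Commun. Math. Phys. **99** (1985) 389–434
[Balaban1985BackgroundPropagators]: Thm 3.3 p. 399, (3.42) p. 397 (third entry «|(G′(U)∇*_Uλ)(x)| ≦ B₀Lʲη e^{−δ₀d(y,y′)}|λ|»), Cor. 3.5 p. 407 («with U = 1, these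
theorems were proved in [4]»), p. 409 l. 1–5 («G_□(U)»), (3.8) p. 392 (`∇*`).  Rows B6.Prop2.6 × B9.Thm3.3 × B9.Cor3.5 (cells only; no row head changes).

WHY THIS FILE (cell `pub-ymgap`, node N06 [B9]; road (B5) of the bond rows; heads of record «KE₂₁X-C» ✓p836416 ∕ «KESC-CO» ✓p836424 display the flat right
half `hRflA` of (3.42)₃ for the Dirichlet bond letter of record — cell GAPS G-B9-02; this seat's LOCATED-36∕38).  The (3.86) transfer of the right entry
`G_□(Ṽ)∇*_ν` (r06 ✓`gExt_rightEntry_of_386L`, p33 ✓`cor36_G_cube_rightEntry_at_locCfg`, p38 ✓`cor36_GK_mul_VK_at_locCfg` for the torus cube letter) needs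
Theorem 3.3's RIGHT entry `G_□(1)∇*_ν` at `U = 1`.  For the torus letter that is p38∕p22's transposed walk (E1 ✓`thm33_GK_cube_right`); for print's Dirichlet
letter `G_□(1) = (Ω₀(Δ_{loc,□} − DP_□D*)(1)Ω₀)⁻¹ = kDirC∣_B` every `U = 1` row is the NAMED printed fact [4] Prop. 2.6 for `G(Ω)` (director-ym №606), and
g33's reading family ✓`gFamOfKernelB` carried only the left-factor entries (`e 2 := 0`, declared).  THIS FILE reads the named fact WITH its printed third entry:
§1 `gFamOfKernelBR i □ K` — `gFamOfKernelB` with `e 2 (J, b) y := [Δ(b) = y]·Σ_ν|(K(∇*_νJ))(b)|`, `∇*_ν = DVa ν c_f` (r03's flat adjoint bond difference = def-Y's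
`cdsB i 1 ν`, ✓`Node00.OpsYOfLetters.cdsB_one`), and `ineq2136_of_ineq2136R` (the 4-entry inequalities imply g33's 3-entry ones); §2 the reading
★`hasMajorant_of_ineq2136R` (`K ≺ C(Lⁿη)²e^{−δ₃d}`, `∇_ν·K ≺ C·Lⁿη·e^{−δ₃d}`, `K·∇*_ν ≺ C·Lⁿη·e^{−δ₃d}`, `Δ·K ≺ Ce^{−δ₃d}`); §3 the lift `hGDs_dirB` of the right
row to the realified interior letter `GiK b i T₁ B · DsK b i ν` (p33's `hGDs_cube` at def-Y's Dirichlet lift clause); §4 the instance `GDirBFamR`,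
★`prop26Dirichlet_of_right` (`h26R ⇒ h26`: ONE displayed named fact serves F1∕F4∕F5∕F6 AND the right entry), and ★★★`thm33_GiK_knit_right_of_prop26DirichletR` —
r06's `h342R` slot for the letter of record `TKnitCY i □` (F1), in both spellings `DsK b i ν` and `conj b(cdsBₗ i 1 ν)`.

WHAT IS PROVED (2 `def`s with bodies — `gFamOfKernelBR`, `GDirBFamR`; theorems; 0 sorry; 0 `def … : Prop`; 0 new named facts; standard axioms):
§1 `gFamOfKernelBR`, `gFamR_e0_self`, `gFamR_e1_self`, `gFamR_e2_self`, `gFamR_e3_self`, `gFam_e_le_gFamR_e` (g33՚s entries ≤ these), ★`ineq2136_of_ineq2136R`;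
§2 ★`hasMajorant_of_ineq2136R`, `hasMajorant_K_DVa_of_ineq2136R`; §3 ★`hGDs_dirB`, `rowsR_GiK_of_ineq2136R`; §4 `GDirBFamR`, ★`prop26Dirichlet_of_right`,
★★★`thm33_GiK_knit_right_of_prop26DirichletR`, `thm33_GiK_knit_right_cdsBₗ_of_prop26DirichletR`.

HONEST SCOPE ∕ NOT CLAIMED.  Pure dictionary + ONE conditional theorem: NO decay is proved here; the decay is the printed assertion [4] Prop. 2.6 (2.136) for
`G(Ω)` (p. 248), taken BY NAME at the 4-entry family (hypothesis `h26R`), exactly as F1 takes it at the 3-entry family (`h26`); `h26R ⇒ h26` is proved, the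
converse is not claimed (the right entry is NOT derivable from the left entries in the block-`ℓ∞` majorant currency — LOCATED-36 (iii) ∕ LOCATED-38 §4: `kDirC∣_B`
is symmetric (✓`B9CubeDirInverseBondSocketAtOne`) but transposition turns row sums into column sums).  The Hölder ∕ (2.137)–(2.140) carriers stay `0` (not read,
declared, as in g33's family).  The bond socket `hKB` is displayed as in F1 (✓`exists_bondSocket` inhabits it).  The (3.86) transfer to `Ṽ` is R3∕R4's business.
Nothing on `d = 4`, the continuum, reflection positivity or the mass gap; NOT a node discharge; count-neutral (`--supports`); no row head changes.  NEW file;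
nothing landed is modified.  `--supports stmt-QuantumFields-27239`.

RELATED IN THE TREE, NOT DUPLICATED (searched 2026-08-31: `rg 'gFamOfKernelBR|GDirBFamR|hasMajorant_of_ineq2136R|hGDs_dirB|thm33_GiK_knit_right'` over `Literature/` +
`Summits/` = ∅): g33 ✓`B9Prop26DirichletBondReading` (3-entry family + reading; USED), ✓`B9Cor35GDirInputsAtOne` (instance `GDirBFam`, `kDirC`, lift lemmas; USED),
F1 ✓`B9Cor35GDirKnitInputsAtOne` (left rows at `TKnitCY`; USED), p33 ✓`B9Thm33CubeAtOneRight` (`DsK`, the torus twin), p33 ✓`B9Cor36GCubeRightEntryAtLocCfg`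
(`conj_cdsBₗ_one`; USED), ✓`B6Prop26DirichletPrinted` (the named fact; not restated).
-/

noncomputable section

namespace Literature.MathematicalPhysics.QuantumFieldTheory.Balaban1983to89.B9Prop26DirichletBondReadingRight

open B6RandomWalk (HasMajorant BlockSupp hasMajorant_mono)
open B9Thm34Ext (toB6)
open B9Eq352DivFormLetters (conj)
open B6KLevelCensusIndexV1 (KIdx kGeo)
open B6Cover236MultiLevelBlocks (cubes)
open B6GlobalChartV1L0 (blkV1)
open B6GradLegKLevelV1 (DV)
open B6LapLegKLevelV1 (DVa LapV)
open B9CubeLettersOpsL0 (cubeFamY)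
open B9CubeLettersBondOpsL0 (BlkCubeY)
open B9CubeGeometryInputs (geoCK geoCK_len geoCK_len_pos geoCK_dist)
open B9Cor35GpCubeInputsAtOne (hasMajorant_conj_of_liftY)
open B9Cor35GCubeInputsAtOne (blkBK DK LapK)
open B9Cor35GpDirInputsAtOne (dirDomY)
open B9Prop26DirichletBondReading (geoDirB gFamOfKernelB geoDirB_len geoDirB_dist geoDirB_M suppIn_of_blockSupp supNorm_le_of_blockSupp pref4_vals
  hasMajorant_of_ineq2136 gFam_e0_self gFam_e1_self gFam_e3_self)
open B9Cor35GDirInputsAtOne (GiK mDirC kDirC geoDirBI domDirBI admDirBI GDirBFam dirInvY_liftY compr_eq_kDirC rows_GiK_of_ineq2136)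
open B9Cor35GDirKnitInputsAtOne (TKnitCY TKnitCY_one_eq_liftOpY_mDirC)
open B9Thm33CubeAtOneRight (DsK)
open B9Cor36GCubeRightEntryAtLocCfg (conj_cdsBₗ_one)
open B9CoReadingCoords (cdsBₗ)
open Node00 (SiteY FBondY toKT liftY liftOpY liftEndY liftEndY_liftY)
open Node00.OpsYCubeDirInverse (indDiagY)
open Node00.OpsYCubeDirInverseBond (bondsOverY)
open scoped Matrix Matrix.Norms.L2Operator

variable {d ℓ : ℕ} {hd : 1 ≤ d + 1} {hL : Odd (ℓ + 1) ∧ 1 < ℓ + 1} {b₀ b₁ : ℝ}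

/-! ## §1  The `GFamily` of a real bond kernel WITH THE RIGHT ENTRY READ -/

section Family

variable (i : KIdx d ℓ hd hL b₀ b₁) (q : ↥(cubes (toKT i).D.toDomains))

/-- **A REAL BOND KERNEL `K` SEEN THROUGH ALL FOUR QUANTITIES OF (2.136)**: for the argument `(J, b)` and the block `y`, `e 0 = |(KJ)(b)|`, `e 1 = Σ_ν|(∇_νKJ)(b)|`,
`e 2 = Σ_ν|(K∇*_νJ)(b)|` (the RIGHT entry, read — g33's ✓`gFamOfKernelB` set it to `0`), `e 3 = |(ΔKJ)(b)|` when `b ∈ Δ(y)` (else `0`), with the V1 lineage's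
continuum-unit bond differences `∇_ν = DV ν c_f`, `∇*_ν = DVa ν c_f` (`c_f·(S_ν⁻¹ − 1)`), `Δ = LapV c_f`; the Hölder ∕ (2.138)–(2.140) carriers are `0` (not read).
[cite: Balaban1984PropagatorsII, Prop. 2.6 (2.136) p.247 (all four entries); Balaban1985BackgroundPropagators, (3.42) p.397, (3.8) p.392, p.409 l.1–5] -/
def gFamOfKernelBR (K : Matrix (FBondY i) (FBondY i) ℝ) : B6.GFamily (geoDirB i q) where
  e n J y := if blkV1 i.hN (cubeFamY i q) J.2 = y then
      (![|(K *ᵥ J.1) J.2|, ∑ ν : Fin (d + 1), |DV (P := B6GlobalChartV1.PV d ℓ i.m i.K hd hL) ν i.cf (K *ᵥ J.1) J.2|,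
        ∑ ν : Fin (d + 1), |(K *ᵥ (DVa (P := B6GlobalChartV1.PV d ℓ i.m i.K hd hL) ν i.cf J.1)) J.2|,
        |LapV (P := B6GlobalChartV1.PV d ℓ i.m i.K hd hL) i.cf (K *ᵥ J.1) J.2|] : Fin 4 → ℝ) n
    else 0
  h1 _ _ _ := 0
  e4 _ _ := 0
  h2 _ _ _ := 0
  l2 _ _ _ := 0

variable (K : Matrix (FBondY i) (FBondY i) ℝ)

/-- `e 0` at the bond's own block is `|(KJ)(b)|`. [cite: Balaban1984PropagatorsII, (2.136)₁ p.247, bookkeeping] -/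
theorem gFamR_e0_self (J : FBondY i → ℝ) (b : FBondY i) :
    (gFamOfKernelBR i q K).e 0 (J, b) (blkV1 i.hN (cubeFamY i q) b) = |(K *ᵥ J) b| := by
  simp [gFamOfKernelBR]

/-- `e 1` at the bond's own block is `Σ_ν|(∇_νKJ)(b)|`. [cite: Balaban1984PropagatorsII, (2.136)₂ p.247, bookkeeping] -/
theorem gFamR_e1_self (J : FBondY i → ℝ) (b : FBondY i) :
    (gFamOfKernelBR i q K).e 1 (J, b) (blkV1 i.hN (cubeFamY i q) b) =
      ∑ ν : Fin (d + 1), |DV (P := B6GlobalChartV1.PV d ℓ i.m i.K hd hL) ν i.cf (K *ᵥ J) b| := by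
  simp [gFamOfKernelBR]

/-- `e 2` at the bond's own block is `Σ_ν|(K∇*_νJ)(b)|` — the right entry. [cite: Balaban1984PropagatorsII, (2.136)₃ p.247, bookkeeping] -/
theorem gFamR_e2_self (J : FBondY i → ℝ) (b : FBondY i) :
    (gFamOfKernelBR i q K).e 2 (J, b) (blkV1 i.hN (cubeFamY i q) b) =
      ∑ ν : Fin (d + 1), |(K *ᵥ (DVa (P := B6GlobalChartV1.PV d ℓ i.m i.K hd hL) ν i.cf J)) b| := by
  simp only [gFamOfKernelBR, if_true]
  rfl

/-- `e 3` at the bond's own block is `|(ΔKJ)(b)|`. [cite: Balaban1984PropagatorsII, (2.136)₄ p.247, bookkeeping] -/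
theorem gFamR_e3_self (J : FBondY i → ℝ) (b : FBondY i) :
    (gFamOfKernelBR i q K).e 3 (J, b) (blkV1 i.hN (cubeFamY i q) b) = |LapV (P := B6GlobalChartV1.PV d ℓ i.m i.K hd hL) i.cf (K *ᵥ J) b| := by
  simp only [gFamOfKernelBR, if_true]
  rfl

/-- the left-factor entries `n = 0, 1, 3` of the 4-entry family ARE g33's; its entry `2` dominates g33's `0`. [cite: Balaban1984PropagatorsII, (2.136) p.247, bookkeeping] -/
theorem gFam_e_le_gFamR_e (n : Fin 4) (J : (geoDirB i q).Loc) (y : (geoDirB i q).Site) :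
    (gFamOfKernelB i q K).e n J y ≤ (gFamOfKernelBR i q K).e n J y := by
  show (if blkV1 i.hN (cubeFamY i q) J.2 = y then _ else (0 : ℝ)) ≤ (if blkV1 i.hN (cubeFamY i q) J.2 = y then _ else (0 : ℝ))
  split_ifs with h
  · fin_cases n
    · exact le_rfl
    · exact le_rfl
    · change (0 : ℝ) ≤ ∑ ν : Fin (d + 1), |(K *ᵥ (DVa (P := B6GlobalChartV1.PV d ℓ i.m i.K hd hL) ν i.cf J.1)) J.2|
      exact Finset.sum_nonneg fun ν _ => abs_nonneg _
    · exact le_rfl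
  · exact le_rfl

/-- ★ **THE 4-ENTRY INEQUALITIES IMPLY g33's 3-ENTRY ONES** (same constants): (2.136)–(2.140) for `gFamOfKernelBR i □ K` give them for `gFamOfKernelB i □ K`
(entries `0, 1, 3` coincide, entry `2` of g33's family is `0 ≤` the printed bound, the Hölder ∕ `L²` carriers are `0` in both).
[cite: Balaban1984PropagatorsII, Prop. 2.6 (2.136)–(2.140) p.247, bookkeeping] -/
theorem ineq2136_of_ineq2136R {C δ₃ : ℝ} {Cα Cε : ℝ → ℝ} {Cαε : ℝ → ℝ → ℝ}
    (h : B6.Ineq2136_2140 (gFamOfKernelBR i q K) C Cα Cε Cαε δ₃) : B6.Ineq2136_2140 (gFamOfKernelB i q K) C Cα Cε Cαε δ₃ := by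
  obtain ⟨h1, h2, h3, h4, h5⟩ := h
  refine ⟨fun n J y y' hJ => (gFam_e_le_gFamR_e i q K n J y).trans (h1 n J y y' hJ), ?_, ?_, ?_, ?_⟩
  · intro α J ζ y y' hα hα1 hζ hJ; exact h2 α J ζ y y' hα hα1 hζ hJ
  · intro ε J y y' hε hε1 hJ; exact h3 ε J y y' hε hε1 hJ
  · intro α ε J ζ y y' hα hε hαε hζ hJ; exact h4 α ε J ζ y y' hα hε hαε hζ hJ
  · intro n J hh y y' hh' hJ; exact h5 n J hh y y' hh' hJ

end Family

/-! ## §2  ★ The reading: (2.136) for `gFamOfKernelBR i □ K` ⇒ the FOUR (3.42)-type rows over `toB6 (geoCK i □)` -/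

section Reading

variable (i : KIdx d ℓ hd hL b₀ b₁) (q : ↥(cubes (toKT i).D.toDomains)) (K : Matrix (FBondY i) (FBondY i) ℝ)

/-- ★ **THE READING WITH THE RIGHT ENTRY**: if `K` satisfies (2.136)–(2.140) in the sense of `Ineq2136_2140 (gFamOfKernelBR i □ K)` with `C ≥ 0` and rate `δ₃`, then over
`toB6 (geoCK i □) Rr H`, keyed by the bond block map: `K ≺ C(Lⁿη)²e^{−δ₃d}`, `∇_ν·K ≺ C·Lⁿη·e^{−δ₃d}` (all `ν`), `K·∇*_ν ≺ C·Lⁿη·e^{−δ₃d}` (all `ν`; `∇*_ν = DVa ν c_f`),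
`Δ·K ≺ Ce^{−δ₃d}` ([4] (2.51)). [cite: Balaban1984PropagatorsII, Prop. 2.6 (2.136) p.247, (2.51) p.232; Balaban1985BackgroundPropagators, Thm 3.3 p.399, (3.42) p.397, Cor. 3.5 p.407, p.409 l.1–5] -/
theorem hasMajorant_of_ineq2136R (Rr : ℝ) (H : Prop) {C δ₃ : ℝ} {Cα Cε : ℝ → ℝ} {Cαε : ℝ → ℝ → ℝ} (hC : 0 ≤ C)
    (h : B6.Ineq2136_2140 (gFamOfKernelBR i q K) C Cα Cε Cαε δ₃) :
    HasMajorant (g := toB6 (geoCK i q) Rr H) (blkV1 i.hN (cubeFamY i q)) (Matrix.toLin' K)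
        (fun y y' => C * (geoCK i q).len y ^ 2 * Real.exp (-(δ₃ * (geoCK i q).dist y y'))) ∧
    (∀ ν : Fin (d + 1), HasMajorant (g := toB6 (geoCK i q) Rr H) (blkV1 i.hN (cubeFamY i q))
        (DV (P := B6GlobalChartV1.PV d ℓ i.m i.K hd hL) ν i.cf ∘ₗ Matrix.toLin' K)
        (fun y y' => C * (geoCK i q).len y * Real.exp (-(δ₃ * (geoCK i q).dist y y')))) ∧
    (∀ ν : Fin (d + 1), HasMajorant (g := toB6 (geoCK i q) Rr H) (blkV1 i.hN (cubeFamY i q))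
        (Matrix.toLin' K ∘ₗ DVa (P := B6GlobalChartV1.PV d ℓ i.m i.K hd hL) ν i.cf)
        (fun y y' => C * (geoCK i q).len y * Real.exp (-(δ₃ * (geoCK i q).dist y y')))) ∧
    HasMajorant (g := toB6 (geoCK i q) Rr H) (blkV1 i.hN (cubeFamY i q))
        (LapV (P := B6GlobalChartV1.PV d ℓ i.m i.K hd hL) i.cf ∘ₗ Matrix.toLin' K)
        (fun y y' => C * Real.exp (-(δ₃ * (geoCK i q).dist y y'))) := by
  obtain ⟨h₀, h₁, h₃⟩ := hasMajorant_of_ineq2136 i q K Rr H hC (ineq2136_of_ineq2136R i q K h)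
  refine ⟨h₀, h₁, fun ν => ?_, h₃⟩
  obtain ⟨h1, -, -, -, -⟩ := h
  intro y' μ B hμ b
  have hμ' : BlockSupp (g := toB6 (geoCK i q) 0 True) (blkV1 i.hN (cubeFamY i q)) μ y' B := ⟨hμ.nonneg, hμ.bound, hμ.off⟩
  have h := h1 2 (μ, b) (blkV1 i.hN (cubeFamY i q) b) y' (suppIn_of_blockSupp i q hμ' b)
  rw [geoDirB_len, geoDirB_dist, gFamR_e2_self, show B6.pref4 ((geoCK i q).len (blkV1 i.hN (cubeFamY i q) b)) 2 = (geoCK i q).len _ from rfl] at h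
  have hw : 0 ≤ C * (geoCK i q).len (blkV1 i.hN (cubeFamY i q) b) * Real.exp (-(δ₃ * (geoCK i q).dist (blkV1 i.hN (cubeFamY i q) b) y')) :=
    mul_nonneg (mul_nonneg hC (geoCK_len_pos i q _).le) (Real.exp_pos _).le
  have h' := h.trans (mul_le_mul_of_nonneg_left (supNorm_le_of_blockSupp i q hμ' b) hw)
  rw [LinearMap.comp_apply, Matrix.toLin'_apply]
  refine le_trans ?_ h'
  exact Finset.single_le_sum (f := fun ν => |(K *ᵥ (DVa (P := B6GlobalChartV1.PV d ℓ i.m i.K hd hL) ν i.cf μ)) b|)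
    (fun ν _ => abs_nonneg _) (Finset.mem_univ ν)

/-- corollary: the `K·∇*_ν`-rows alone. [cite: Balaban1984PropagatorsII, (2.136)₃ p.247; Balaban1985BackgroundPropagators, (3.42)₃ p.397, Cor. 3.5 p.407] -/
theorem hasMajorant_K_DVa_of_ineq2136R (Rr : ℝ) (H : Prop) {C δ₃ : ℝ} {Cα Cε : ℝ → ℝ} {Cαε : ℝ → ℝ → ℝ} (hC : 0 ≤ C)
    (h : B6.Ineq2136_2140 (gFamOfKernelBR i q K) C Cα Cε Cαε δ₃) (ν : Fin (d + 1)) :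
    HasMajorant (g := toB6 (geoCK i q) Rr H) (blkV1 i.hN (cubeFamY i q))
      (Matrix.toLin' K ∘ₗ DVa (P := B6GlobalChartV1.PV d ℓ i.m i.K hd hL) ν i.cf)
      (fun y y' => C * (geoCK i q).len y * Real.exp (-(δ₃ * (geoCK i q).dist y y'))) :=
  (hasMajorant_of_ineq2136R i q K Rr H hC h).2.2.1 ν

end Reading

/-! ## §3  ★ The lift of the right row to the realified interior Dirichlet letter `GiK b i T₁ B · DsK b i ν` -/

section Lift

variable {𝔸 : Type} [NormedRing 𝔸] [NormedAlgebra ℂ 𝔸]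
variable {ι : Type} [Fintype ι] (b : Module.Basis ι ℝ 𝔸)
variable (i : KIdx d ℓ hd hL b₀ b₁) (q : ↥(cubes (toKT i).D.toDomains))
variable {T₁ : (FBondY i → 𝔸) →ₗ[ℂ] (FBondY i → 𝔸)} {B : Finset (FBondY i)} {M KB : Matrix (FBondY i) (FBondY i) ℝ}

/-- ★ **ROW `hGDs ν` AT THE DIRICHLET BOND LETTER** ((3.42)₃-type entry `G·∇*_ν`): for ANY flat operator `T₁ = M♯`, bond set `B` and real `K_B` inverting the
compression, a block majorant `(𝟙K_B𝟙)·∇*_ν ≺ A·Lⁿη·e^{−δd}` of the real interior kernel gives `GiK b i T₁ B · DsK b i ν ≺ A·Lⁿη·e^{−δd}` for the realified interior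
letter (def-Y's lift clause ✓`dirInvY_liftY`, `DsK = conj b((DVa ν c_f)♯)`; p33's `hGDs_cube` at the Dirichlet letter).
[cite: Balaban1985BackgroundPropagators, Thm 3.3 p.399, (3.42)₃ p.397, Cor. 3.5 p.407, p.409 l.1–5; Balaban1984PropagatorsII, Prop. 2.6 (2.136)₃ p.247, (2.51) p.232] -/
theorem hGDs_dirB (hT1 : T₁ = liftOpY 𝔸 M)
    (hKB : M.submatrix (fun v : ↥B => (v : FBondY i)) (fun v : ↥B => (v : FBondY i)) *
      KB.submatrix (fun v : ↥B => (v : FBondY i)) (fun v : ↥B => (v : FBondY i)) = 1) {A δ : ℝ} (Rr : ℝ) (H : Prop) (ν : Fin (d + 1))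
    (h₂ : HasMajorant (g := toB6 (geoCK i q) Rr H) (blkV1 i.hN (cubeFamY i q))
      (Matrix.toLin' (indDiagY B * KB * indDiagY B) ∘ₗ DVa (P := B6GlobalChartV1.PV d ℓ i.m i.K hd hL) ν i.cf)
      (fun y y' => A * (geoCK i q).len y * Real.exp (-(δ * (geoCK i q).dist y y')))) :
    HasMajorant (g := toB6 (geoCK i q) Rr H) (blkBK i q) (GiK b i T₁ B * DsK b i ν)
      (fun a a' => A * (geoCK i q).len a * Real.exp (-(δ * (geoCK i q).dist a a'))) := by
  rw [DsK, GiK, ← B9Eq352DivFormLetters.conj_mul]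
  refine hasMajorant_conj_of_liftY b (g := toB6 (geoCK i q) Rr H) (blkV1 i.hN (cubeFamY i q)) _ _ (fun J E => ?_) h₂
  have h1 := dirInvY_liftY i hT1 hKB (DVa (P := B6GlobalChartV1.PV d ℓ i.m i.K hd hL) ν i.cf J) E
  rw [LinearMap.restrictScalars_apply] at h1
  rw [Module.End.mul_apply, LinearMap.restrictScalars_apply, LinearMap.restrictScalars_apply, liftEndY_liftY, h1, LinearMap.comp_apply,
    Matrix.toLin'_apply]

/-- ★★ **THE FOUR ROWS OF THE INTERIOR LETTER FROM A 4-ENTRY (2.136)-SHAPED DECAY OF ITS KERNEL**: g33's three (✓`rows_GiK_of_ineq2136`) and the right one.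
[cite: Balaban1984PropagatorsII, Prop. 2.6 (2.136) p.247, (2.51) p.232; Balaban1985BackgroundPropagators, Thm 3.3 p.399, (3.42) p.397, Cor. 3.5 p.407, p.409 l.1–5] -/
theorem rowsR_GiK_of_ineq2136R (hT1 : T₁ = liftOpY 𝔸 M)
    (hKB : M.submatrix (fun v : ↥B => (v : FBondY i)) (fun v : ↥B => (v : FBondY i)) *
      KB.submatrix (fun v : ↥B => (v : FBondY i)) (fun v : ↥B => (v : FBondY i)) = 1) (Rr : ℝ) (H : Prop)
    {C δ₃ : ℝ} {Cα Cε : ℝ → ℝ} {Cαε : ℝ → ℝ → ℝ} (hC : 0 ≤ C)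
    (hdec : B6.Ineq2136_2140 (gFamOfKernelBR i q (indDiagY B * KB * indDiagY B)) C Cα Cε Cαε δ₃) :
    HasMajorant (g := toB6 (geoCK i q) Rr H) (blkBK i q) (GiK b i T₁ B)
        (fun a a' => C * (geoCK i q).len a ^ 2 * Real.exp (-(δ₃ * (geoCK i q).dist a a'))) ∧
    (∀ ν : Fin (d + 1), HasMajorant (g := toB6 (geoCK i q) Rr H) (blkBK i q) (DK b i ν * GiK b i T₁ B)
        (fun a a' => C * (geoCK i q).len a * Real.exp (-(δ₃ * (geoCK i q).dist a a')))) ∧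
    (∀ ν : Fin (d + 1), HasMajorant (g := toB6 (geoCK i q) Rr H) (blkBK i q) (GiK b i T₁ B * DsK b i ν)
        (fun a a' => C * (geoCK i q).len a * Real.exp (-(δ₃ * (geoCK i q).dist a a')))) ∧
    HasMajorant (g := toB6 (geoCK i q) Rr H) (blkBK i q) (LapK b i * GiK b i T₁ B)
        (fun a a' => C * Real.exp (-(δ₃ * (geoCK i q).dist a a'))) := by
  obtain ⟨h₀, h₁, h₃⟩ := rows_GiK_of_ineq2136 b i q hT1 hKB Rr H hC (ineq2136_of_ineq2136R i q _ hdec)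
  exact ⟨h₀, h₁, fun ν => hGDs_dirB b i q hT1 hKB Rr H ν (hasMajorant_K_DVa_of_ineq2136R i q _ Rr H hC hdec ν), h₃⟩

end Lift

/-! ## §4  ★★★ The instance WITH the right entry, `h26R ⇒ h26`, and Theorem 3.3 (3.42)₃ at `U = 1` for the letter of record, conditional by name -/

section Instance

/-- **THE FAMILY `GΩ` OF THE INSTANCE WITH THE RIGHT ENTRY READ: print's `G_□(1) = (Ω₀(Δ_{loc,□} − DP_□D*)(1)Ω₀)⁻¹` SEEN THROUGH ALL FOUR QUANTITIES OF
(2.136)** — §1's `gFamOfKernelBR` at g33's canonical Dirichlet bond kernel `kDirC` (defined for every `S`; read at the admissible `S = Ω₀(□)`).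
[cite: Balaban1984PropagatorsII, Prop. 2.6 (2.136) p.247, p.228, p.248 l.4–5; Balaban1985BackgroundPropagators, p.409 l.3–5, Cor. 3.5 p.407] -/
def GDirBFamR (p : B9Cor35GDirInputsAtOne.CubeIdxB d ℓ hd hL b₀ b₁) (_S : domDirBI p) : B6.GFamily (geoDirBI p) :=
  gFamOfKernelBR p.1 p.2 (kDirC p.1 p.2)

/-- ★ **`h26R ⇒ h26`**: [4] Prop. 2.6 for `G(Ω)` at the 4-entry family implies it at g33's 3-entry family (same constants) — so ONE displayed named fact `h26R`
serves F1∕F4∕F5∕F6 (which take `h26`) and the right entry. [cite: Balaban1984PropagatorsII, Prop. 2.6 (2.136) p.247, p.248 l.4–5, bookkeeping] -/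
theorem prop26Dirichlet_of_right
    (h26R : B6.Prop26DirichletPrinted (geoDirBI (d := d) (ℓ := ℓ) (hd := hd) (hL := hL) (b₀ := b₀) (b₁ := b₁)) domDirBI admDirBI GDirBFamR) :
    B6.Prop26DirichletPrinted (geoDirBI (d := d) (ℓ := ℓ) (hd := hd) (hL := hL) (b₀ := b₀) (b₁ := b₁)) domDirBI admDirBI GDirBFam := by
  obtain ⟨M₁, δ₃, C, Cα, Cε, Cαε, hM₁, hδ₃, hC, H⟩ := h26R
  exact ⟨M₁, δ₃, C, Cα, Cε, Cαε, hM₁, hδ₃, hC, fun p h21 hM S hS => ineq2136_of_ineq2136R p.1 p.2 _ (H p h21 hM S hS)⟩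

variable {N : ℕ} [Nonempty (Fin N)]
variable {ι : Type} [Fintype ι] (b : Module.Basis ι ℝ (Matrix (Fin N) (Fin N) ℂ))

/-- ★★★ **THEOREM 3.3 (3.42)₃ AT `U = 1` FOR THE REALIFIED DIRICHLET BOND LETTER OF RECORD OF EVERY CUBE OF EVERY MEMBER, ONE SET OF CONSTANTS — CONDITIONAL BY
NAME ON [4] PROP. 2.6 FOR `G(Ω)` READ WITH ITS THIRD ENTRY**: IF `B6.Prop26DirichletPrinted` holds at the 4-entry family `GDirBFamR`, THEN there are `M₁, δ₃, C > 0`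
such that for every member `i` above the threshold `M₁ ≤ L·M_h`, every cover cube `□`, every `Rr, H` and every real `K_B` inverting the compression of the canonical
matrix `mDirC i □` to `B = bondsOverY Ω₀(□)`: all FOUR rows of `GiK b i (TKnitCY i □ 1) B` — `GiK ≺ C(Lⁿη)²e^{−δ₃d}`, `conj b(∇_ν)·GiK ≺ C·Lⁿη·e^{−δ₃d}`,
`GiK·DsK b i ν ≺ C·Lⁿη·e^{−δ₃d}` (the RIGHT entry, r06's `h342R` slot), `conj b(Δ)·GiK ≺ Ce^{−δ₃d}` over `toB6 (geoCK i □) Rr H` keyed by `blkBK i □`.  The decay is the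
NAMED printed assertion (hypothesis `h26R`), not proved here; the bond socket `hKB` is displayed (✓`exists_bondSocket` inhabits it).
[cite: Balaban1985BackgroundPropagators, Thm 3.3 p.399, (3.42) p.397 (third entry), Cor. 3.5 p.407, p.409 l.1–5; Balaban1984PropagatorsII, Prop. 2.6 (2.136) p.247, p.228, p.248 l.4–5, (2.51) p.232] -/
theorem thm33_GiK_knit_right_of_prop26DirichletR
    (h26R : B6.Prop26DirichletPrinted (geoDirBI (d := d) (ℓ := ℓ) (hd := hd) (hL := hL) (b₀ := b₀) (b₁ := b₁)) domDirBI admDirBI GDirBFamR) :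
    ∃ M₁ δ₃ C : ℝ, 0 < M₁ ∧ 0 < δ₃ ∧ 0 < C ∧
    ∀ (i : KIdx d ℓ hd hL b₀ b₁) (q : ↥(cubes (toKT i).D.toDomains)) (Rr : ℝ) (H : Prop) (KB : Matrix (FBondY i) (FBondY i) ℝ),
      (mDirC i q).submatrix (fun v : ↥(bondsOverY i (dirDomY i q)) => (v : FBondY i)) (fun v : ↥(bondsOverY i (dirDomY i q)) => (v : FBondY i)) *
        KB.submatrix (fun v : ↥(bondsOverY i (dirDomY i q)) => (v : FBondY i)) (fun v : ↥(bondsOverY i (dirDomY i q)) => (v : FBondY i)) = 1 →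
      M₁ ≤ ((ℓ : ℝ) + 1) * i.Mh →
      HasMajorant (g := toB6 (geoCK i q) Rr H) (blkBK i q) (GiK b i (TKnitCY i q (fun _ _ => 1)) (bondsOverY i (dirDomY i q)))
          (fun a a' => C * (geoCK i q).len a ^ 2 * Real.exp (-(δ₃ * (geoCK i q).dist a a'))) ∧
      (∀ ν : Fin (d + 1), HasMajorant (g := toB6 (geoCK i q) Rr H) (blkBK i q) (DK b i ν * GiK b i (TKnitCY i q (fun _ _ => 1)) (bondsOverY i (dirDomY i q)))
          (fun a a' => C * (geoCK i q).len a * Real.exp (-(δ₃ * (geoCK i q).dist a a')))) ∧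
      (∀ ν : Fin (d + 1), HasMajorant (g := toB6 (geoCK i q) Rr H) (blkBK i q) (GiK b i (TKnitCY i q (fun _ _ => 1)) (bondsOverY i (dirDomY i q)) * DsK b i ν)
          (fun a a' => C * (geoCK i q).len a * Real.exp (-(δ₃ * (geoCK i q).dist a a')))) ∧
      HasMajorant (g := toB6 (geoCK i q) Rr H) (blkBK i q) (LapK b i * GiK b i (TKnitCY i q (fun _ _ => 1)) (bondsOverY i (dirDomY i q)))
          (fun a a' => C * Real.exp (-(δ₃ * (geoCK i q).dist a a'))) := by
  obtain ⟨M₁, δ₃, C, Cα, Cε, Cαε, hM₁, hδ₃, hC, H⟩ := h26R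
  refine ⟨M₁, δ₃, C, hM₁, hδ₃, hC, fun i q Rr Hh KB hKB hM => ?_⟩
  have hT1 := TKnitCY_one_eq_liftOpY_mDirC (N := N) i q
  have hKc : indDiagY (bondsOverY i (dirDomY i q)) * KB * indDiagY (bondsOverY i (dirDomY i q)) = kDirC i q := compr_eq_kDirC i q hKB
  have hineq : B6.Ineq2136_2140 (gFamOfKernelBR i q (indDiagY (bondsOverY i (dirDomY i q)) * KB * indDiagY (bondsOverY i (dirDomY i q)))) C Cα Cε Cαε δ₃ := by
    rw [hKc]
    have hM' : M₁ ≤ (geoDirBI ⟨i, q⟩).M := by rw [show (geoDirBI ⟨i, q⟩).M = ((ℓ : ℝ) + 1) * i.Mh from geoDirB_M i q]; exact hM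
    exact H ⟨i, q⟩ trivial hM' (dirDomY i q) rfl
  exact rowsR_GiK_of_ineq2136R b i q hT1 hKB Rr Hh hC.le hineq

/-- ★★★ the right row in the CONSUMER's spelling `conj b(cdsBₗ i 1 ν)` (def-Y's flat adjoint bond derivative realified = `DsK b i ν`, p33's ✓`conj_cdsBₗ_one`) — the `U = 1`
face of F5's ∕ F6's displayed flat half. [cite: Balaban1985BackgroundPropagators, Thm 3.3 p.399, (3.42)₃ p.397, (3.8) p.392, Cor. 3.5 p.407, p.409 l.1–5; Balaban1984PropagatorsII, Prop. 2.6 (2.136)₃ p.247, p.248 l.4–5] -/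
theorem thm33_GiK_knit_right_cdsBₗ_of_prop26DirichletR
    (h26R : B6.Prop26DirichletPrinted (geoDirBI (d := d) (ℓ := ℓ) (hd := hd) (hL := hL) (b₀ := b₀) (b₁ := b₁)) domDirBI admDirBI GDirBFamR) :
    ∃ M₁ δ₃ C : ℝ, 0 < M₁ ∧ 0 < δ₃ ∧ 0 < C ∧
    ∀ (i : KIdx d ℓ hd hL b₀ b₁) (q : ↥(cubes (toKT i).D.toDomains)) (Rr : ℝ) (H : Prop) (KB : Matrix (FBondY i) (FBondY i) ℝ),
      (mDirC i q).submatrix (fun v : ↥(bondsOverY i (dirDomY i q)) => (v : FBondY i)) (fun v : ↥(bondsOverY i (dirDomY i q)) => (v : FBondY i)) *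
        KB.submatrix (fun v : ↥(bondsOverY i (dirDomY i q)) => (v : FBondY i)) (fun v : ↥(bondsOverY i (dirDomY i q)) => (v : FBondY i)) = 1 →
      M₁ ≤ ((ℓ : ℝ) + 1) * i.Mh →
      ∀ ν : Fin (d + 1), HasMajorant (g := toB6 (geoCK i q) Rr H) (blkBK i q)
        (GiK b i (TKnitCY i q (fun _ _ => 1)) (bondsOverY i (dirDomY i q)) * conj b (cdsBₗ i (fun _ _ => (1 : (Matrix (Fin N) (Fin N) ℂ)ˣ)) ν))
        (fun a a' => C * (geoCK i q).len a * Real.exp (-(δ₃ * (geoCK i q).dist a a'))) := by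
  obtain ⟨M₁, δ₃, C, hM₁, hδ₃, hC, H⟩ := thm33_GiK_knit_right_of_prop26DirichletR (N := N) b h26R
  refine ⟨M₁, δ₃, C, hM₁, hδ₃, hC, fun i q Rr Hh KB hKB hM ν => ?_⟩
  rw [conj_cdsBₗ_one]
  exact (H i q Rr Hh KB hKB hM).2.2.1 ν

end Instance

end Literature.MathematicalPhysics.QuantumFieldTheory.Balaban1983to89.B9Prop26DirichletBondReadingRight

end
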